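import Literature.Analysis.FluidPDE.PassiveScalarForced
import Literature.Analysis.FluidPDE.PassiveScalarClassicalEnergy
import Literature.Analysis.FluidPDE.PassiveScalarRenormalizedSlice
import Literature.Analysis.FunctionSpaces.TorusSpaceTimeComposition
import Literature.Analysis.FunctionSpaces.TorusSpaceTimeFields
import Mathlib.Analysis.SpecialFunctions.Sqrt
import Mathlib.Analysis.Calculus.MeanValue
import Mathlib.MeasureTheory.Integral.IntervalIntegral.FundThmCalculus
import Mathlib.MeasureTheory.Integral.DominatedConvergence
import Mathlib.Analysis.SpecialFunctions.SmoothTransition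

/-!
# Convex (renormalised) functionals of classical passive scalars WITH A SOURCE:
# `d/dt ∫ β(θ) = -κ ∫ β″(θ)‖∇θ‖² + ∫ β′(θ) s` — diffusion and transport never raise them,
# only the source does

Topic `Literature/Analysis/FluidPDE` (passive-scalar cluster; theorems only, no definitions, no
named facts). The sourced twin of `PassiveScalarClassicalEntropy.lean`. For a classical (jointly
smooth) solution `θ` of the forced advection–diffusion equation
`∂ₜθ + u·∇θ = κΔθ + s`, `div u = 0`, on `S × T^d`
(`Torus.IsClassicalScalarTransportForcedOn S κ u s θ`, `PassiveScalarForced.lean`) and a smooth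
`β : ℝ → ℝ`:

* `IsClassicalScalarTransportForcedOn.hasDerivWithinAt_integral_comp` — the **renormalised
  balance with source** `d/dt ∫ β(θ(t)) = -κ ∫ β″(θ(t))‖∇θ(t)‖² + ∫ β′(θ(t)) s(t)` within a
  convex time set (differentiate under `∫_{T^d}`, chain rule, the equation; the transport term
  `∫ β′(θ)⟪u, ∇θ⟫` vanishes by incompressibility and `∫ β′(θ)Δθ = -∫ β″(θ)‖∇θ‖²` — the two
  integrations by parts of the tree, `PassiveScalarRenormalizedSlice`). This is the classical case
  of the DiPerna–Lions renormalisation for the equation with a right-hand side (Invent. Math. 98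
  (1989), §II.3–§II.4: `β(θ)` solves the equation with source `β′(θ) s`); `β = id` is the **mean
  balance** `d/dt ∫ θ = ∫ s` (`…hasDerivWithinAt_integral`, `…integral_sub_integral_eq`);
* `…integral_comp_sub_integral_comp_le` — for `κ ≥ 0` and CONVEX smooth `β` (`β″ ≥ 0`), on every
  `[a, b] ⊆ S`: `∫ β(θ(t)) − ∫ β(θ(a)) ≤ ∫ₐᵗ ∫ β′(θ) s` — diffusion only dissipates;
* by the smooth convex approximations `√(r² + ε²) → |r|` and `(r + √(r² + ε²))/2 → r⁺` (whose
  first derivatives lie in `[-1, 1]`, resp. `[0, 1]`, so that `β′_ε(θ) s ≤ |s|`, resp. `≤ s⁺`):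
  `…integral_posPart_sub_le` — **the co-signed mass obeys `∫ θ(t)⁺ − ∫ θ(a)⁺ ≤ ∫ₐᵗ∫ s⁺`** (and
  the level-`c` form `…integral_posPart_sub_sub_le`); `…integral_negPart_sub_le` —
  `∫ θ(t)⁻ − ∫ θ(a)⁻ ≤ ∫ₐᵗ∫ s⁻`; `…integral_abs_sub_le` — `∫ |θ(t)| − ∫ |θ(a)| ≤ ∫ₐᵗ∫ |s|`;
  `…antitoneOn_integral_posPart_of_nonpos` — a nonpositive source (absorption) never raises
  `∫ θ⁺`; and by linearity (`…sub_source`) the **`L¹`-stability** `…integral_abs_sub_sub_le`: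
  `∫ |θ₁(t) − θ₂(t)| − ∫ |θ₁(a) − θ₂(a)| ≤ ∫ₐᵗ∫ |s₁ − s₂|` for two solutions with the same drift
  (the Crandall–Tartar 1980 / Kružkov `L¹`-contraction with sources, classical periodic case);
* by the approximants `P_δ(w) = ∫₀ʷ smoothTransition(r/δ) dr` (whose derivatives tend to
  `1_{(0,∞)}` EVERYWHERE, not to `½` on the zero set): the LOCALISED, SIGNED form
  `…integral_posPart_sub_sub_le_setIntegral` — **`∫ (θ(t) − c)⁺ − ∫ (θ(a) − c)⁺ ≤ ∫ₐᵗ ∫_{θ > c} s`**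
  (the source counts with its sign and only on the super-level set; dominated convergence in `x`
  and `τ`), `…integral_posPart_sub_le_setIntegral` (`c = 0`) and
  `…integral_posPart_sub_le_of_ae_pos` (an era with `θ > 0` a.e. obeys `≤ ∫ₐᵗ∫ s`).
* (section `SuperlevelFlux`, smooth fields on `T^d`, no equation) the smeared Gauss–Green
  theorem on a super-level set: `Torus.tendsto_integral_approxIndicator_mul`
  (`∫ gₙ(θ) G → ∫_{θ > 0} G` for the approximate indicators `gₙ = smoothTransition((n+1)·)`),
  `Torus.integral_deriv_comp_mul_sum_partialDeriv_mul_eq` (`∫ g'(θ) ∑ₖ ∂ₖθ Fₖ = −∫ g(θ) ∑ₖ ∂ₖFₖ`)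
  and **`Torus.tendsto_integral_thinBand_flux`** —
  `∫ gₙ'(θ) ∑ₖ ∂ₖθ Fₖ → −∫_{θ > 0} div F`: the integral of a divergence over `{θ > 0}` is the
  limit of the fluxes of `F` against `∇θ` through the thin nodal bands `{0 < θ < 1/(n+1)}`
  (Evans 2010, App. C.2 Thm. 1 for `U = {θ > 0}`, in a form needing no regularity of `{θ = 0}`).

Reading for three-dimensional Navier–Stokes (census «H_ν» of the cell `ns-blowup`, (iii) theorem
side): every Cartesian entry `Wᵢⱼ = ∂ᵢuⱼ − ∂ⱼuᵢ` of the vorticity tensor of a classical solution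
on `T^d` is such a forced scalar, driven by its own velocity, with source the stretching–tilting
term `−((∇u∇u)ᵢⱼ − (∇u∇u)ⱼᵢ)` plus the curl of the force (Majda–Bertozzi 2002, (1.31); tree
`IsClassicalNSSolutionOn.timeDerivWithin_torusVorticityTensor`) — so the section-averaged
co-signed flux `∫ (ω·e)⁺` in a fixed direction rises ONLY through the positive part of the
inviscid source; the viscous channel contributes `≤ 0` in every dimension (sequel file
`TorusVorticityComponentCoSignedFlux`). Nothing here decides the sign of the stretching term.

## References

* R. J. DiPerna, P.-L. Lions, *Ordinary differential equations, transport theory and Sobolev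
  spaces*, Invent. Math. 98 (1989), 511–547, §II.3–§II.4 (renormalisation; equations with a
  right-hand side). [`DiPernaLions1989Invent`]
* Th. Gallay, C. E. Wayne, *Global stability of vortex solutions of the two-dimensional
  Navier–Stokes equation*, Comm. Math. Phys. 255 (2005), 97–129 = arXiv:math/0402449, §3.1,
  Lemma 3.1 (the unforced case: `∫ |w|` non-increasing). [`GallayWayne2005`]
* M. G. Crandall, L. Tartar, *Some relations between nonexpansive and order preserving mappings*,
  Proc. Amer. Math. Soc. 78 (1980), 385–390, Prop. 1. [`CrandallTartar1980`]
* A. J. Majda, A. L. Bertozzi, *Vorticity and Incompressible Flow*, CUP (2002), §1.4 (1.31),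
  §2.1 (2.6). [`MajdaBertozziCUP2002`]
* L. C. Evans, *Partial Differential Equations*, 2nd ed., AMS (2010), App. C.2 Thms. 1–2
  (Gauss–Green, integration by parts). [`Evans2010`]
* T. Drivas, T. Elgindi, G. Iyer, I.-J. Jeong, *Anomalous dissipation in passive scalar
  transport*, Arch. Ration. Mech. Anal. 243 (2022), 1151–1180, (1.1) (the equation; the tree's
  notion `IsClassicalScalarTransportForcedOn` cites it). [`DrivasEtAl2022`]
-/

open MeasureTheory Set Filter
open _root_.Topology
open scoped InnerProductSpace ContDiff

noncomputable section

namespace Literature.Analysis.FluidPDE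

namespace Torus

variable {d : Type*} [Fintype d] [DecidableEq d]

/-! ## Smooth convex approximations of `|r|` and `r⁺` (written out in full; no definitions) -/

section Approximants

/-- `r² + ε² > 0` for `ε ≠ 0`. [folklore] -/
private theorem sq_add_sq_pos₁ {ε : ℝ} (hε : ε ≠ 0) (r : ℝ) : 0 < r ^ 2 + ε ^ 2 := by
  have := sq_nonneg r
  have := pow_pos (abs_pos.2 hε) 2
  rw [sq_abs] at this
  linarith

/-- `√(r² + ε²) > 0` for `ε ≠ 0`. [folklore] -/
private theorem smoothAbs_pos₁ {ε : ℝ} (hε : ε ≠ 0) (r : ℝ) : 0 < Real.sqrt (r ^ 2 + ε ^ 2) :=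
  Real.sqrt_pos.2 (sq_add_sq_pos₁ hε r)

/-- `r ↦ √(r² + ε²)` is smooth for `ε ≠ 0`. [folklore] -/
private theorem contDiff_smoothAbs₁ {ε : ℝ} (hε : ε ≠ 0) :
    ContDiff ℝ ∞ (fun r => Real.sqrt (r ^ 2 + ε ^ 2)) :=
  ((contDiff_id.pow 2).add contDiff_const).sqrt fun r => (sq_add_sq_pos₁ hε r).ne'

/-- `r ↦ (r + √(r² + ε²))/2` is smooth for `ε ≠ 0`. [folklore] -/
private theorem contDiff_smoothPos₁ {ε : ℝ} (hε : ε ≠ 0) :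
    ContDiff ℝ ∞ (fun r => (r + Real.sqrt (r ^ 2 + ε ^ 2)) / 2) :=
  (contDiff_id.add (contDiff_smoothAbs₁ hε)).div_const 2

/-- `d/dr √(r² + ε²) = r / √(r² + ε²)`. [folklore] -/
private theorem hasDerivAt_smoothAbs₁ {ε : ℝ} (hε : ε ≠ 0) (r : ℝ) :
    HasDerivAt (fun r => Real.sqrt (r ^ 2 + ε ^ 2)) (r / Real.sqrt (r ^ 2 + ε ^ 2)) r := by
  have h1 : HasDerivAt (fun r : ℝ => r ^ 2 + ε ^ 2) (2 * r) r := by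
    simpa using ((hasDerivAt_id r).pow 2).add_const (ε ^ 2)
  have h2 := h1.sqrt (sq_add_sq_pos₁ hε r).ne'
  convert h2 using 1
  field_simp

/-- `(√(r² + ε²))′ = r/√(r² + ε²)` as a function. [folklore] -/
private theorem deriv_smoothAbs₁ {ε : ℝ} (hε : ε ≠ 0) :
    deriv (fun r => Real.sqrt (r ^ 2 + ε ^ 2)) = fun r => r / Real.sqrt (r ^ 2 + ε ^ 2) :=
  funext fun r => (hasDerivAt_smoothAbs₁ hε r).deriv

/-- `|(√(r² + ε²))′| ≤ 1`: the smooth absolute value is `1`-Lipschitz. [folklore] -/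
private theorem abs_deriv_smoothAbs_le_one {ε : ℝ} (hε : ε ≠ 0) (r : ℝ) :
    |deriv (fun r => Real.sqrt (r ^ 2 + ε ^ 2)) r| ≤ 1 := by
  rw [deriv_smoothAbs₁ hε]
  have hpos := smoothAbs_pos₁ hε r
  have hle : |r| ≤ Real.sqrt (r ^ 2 + ε ^ 2) := Real.abs_le_sqrt (by nlinarith [sq_nonneg ε])
  rw [abs_div, abs_of_pos hpos, div_le_one hpos]
  exact hle

/-- `d²/dr² √(r² + ε²) = ε² / (√(r² + ε²))³`. [folklore] -/
private theorem hasDerivAt_deriv_smoothAbs₁ {ε : ℝ} (hε : ε ≠ 0) (r : ℝ) :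
    HasDerivAt (deriv (fun r => Real.sqrt (r ^ 2 + ε ^ 2)))
      (ε ^ 2 / Real.sqrt (r ^ 2 + ε ^ 2) ^ 3) r := by
  rw [deriv_smoothAbs₁ hε]
  have hg := hasDerivAt_smoothAbs₁ hε r
  have hpos := smoothAbs_pos₁ hε r
  have hsq : Real.sqrt (r ^ 2 + ε ^ 2) ^ 2 = r ^ 2 + ε ^ 2 := by
    rw [Real.sq_sqrt (sq_add_sq_pos₁ hε r).le]
  have h : HasDerivAt (fun y => y / Real.sqrt (y ^ 2 + ε ^ 2))
      ((1 * Real.sqrt (r ^ 2 + ε ^ 2) - r * (r / Real.sqrt (r ^ 2 + ε ^ 2))) /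
        Real.sqrt (r ^ 2 + ε ^ 2) ^ 2) r :=
    (hasDerivAt_id r).div hg hpos.ne'
  refine h.congr_deriv ?_
  have e : 1 * Real.sqrt (r ^ 2 + ε ^ 2) - r * (r / Real.sqrt (r ^ 2 + ε ^ 2)) =
      ε ^ 2 / Real.sqrt (r ^ 2 + ε ^ 2) := by
    field_simp
    nlinarith [hsq]
  rw [e, div_div, ← pow_succ']

/-- Convexity of `√(r² + ε²)`: its second derivative is `≥ 0`. [folklore] -/
private theorem deriv_deriv_smoothAbs_nonneg₁ {ε : ℝ} (hε : ε ≠ 0) (r : ℝ) :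
    0 ≤ deriv (deriv (fun r => Real.sqrt (r ^ 2 + ε ^ 2))) r := by
  rw [(hasDerivAt_deriv_smoothAbs₁ hε r).deriv]
  exact div_nonneg (sq_nonneg ε) (pow_nonneg (smoothAbs_pos₁ hε r).le 3)

/-- `((r + √(r² + ε²))/2)′ = (1 + (√(r² + ε²))′)/2`. [folklore] -/
private theorem deriv_smoothPos₁ {ε : ℝ} (hε : ε ≠ 0) :
    deriv (fun r => (r + Real.sqrt (r ^ 2 + ε ^ 2)) / 2) =
      fun r => (1 + deriv (fun r => Real.sqrt (r ^ 2 + ε ^ 2)) r) / 2 := by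
  funext r
  have h : HasDerivAt (fun r => (r + Real.sqrt (r ^ 2 + ε ^ 2)) / 2)
      ((1 + r / Real.sqrt (r ^ 2 + ε ^ 2)) / 2) r :=
    ((hasDerivAt_id r).add (hasDerivAt_smoothAbs₁ hε r)).div_const 2
  rw [h.deriv, deriv_smoothAbs₁ hε]

/-- The smooth positive part is non-decreasing and `1`-Lipschitz: `0 ≤ P_ε′ ≤ 1`. [folklore] -/
private theorem deriv_smoothPos_mem_Icc {ε : ℝ} (hε : ε ≠ 0) (r : ℝ) :
    deriv (fun r => (r + Real.sqrt (r ^ 2 + ε ^ 2)) / 2) r ∈ Icc (0 : ℝ) 1 := by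
  rw [deriv_smoothPos₁ hε]
  have h := abs_le.1 (abs_deriv_smoothAbs_le_one hε r)
  constructor
  · dsimp only; linarith [h.1]
  · dsimp only; linarith [h.2]

/-- Convexity of `(r + √(r² + ε²))/2`: its second derivative is `≥ 0`. [folklore] -/
private theorem deriv_deriv_smoothPos_nonneg₁ {ε : ℝ} (hε : ε ≠ 0) (r : ℝ) :
    0 ≤ deriv (deriv (fun r => (r + Real.sqrt (r ^ 2 + ε ^ 2)) / 2)) r := by
  rw [deriv_smoothPos₁ hε]
  have h : HasDerivAt (fun r => (1 + deriv (fun r => Real.sqrt (r ^ 2 + ε ^ 2)) r) / 2)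
      ((0 + ε ^ 2 / Real.sqrt (r ^ 2 + ε ^ 2) ^ 3) / 2) r :=
    ((hasDerivAt_const r (1 : ℝ)).add (hasDerivAt_deriv_smoothAbs₁ hε r)).div_const 2
  rw [h.deriv, zero_add]
  exact div_nonneg (div_nonneg (sq_nonneg ε) (pow_nonneg (smoothAbs_pos₁ hε r).le 3)) zero_le_two

/-- `|r| ≤ √(r² + ε²)`. [folklore] -/
private theorem abs_le_smoothAbs₁ (ε r : ℝ) : |r| ≤ Real.sqrt (r ^ 2 + ε ^ 2) :=
  Real.abs_le_sqrt (by nlinarith [sq_nonneg ε])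

/-- `√(r² + ε²) ≤ |r| + |ε|`. [folklore] -/
private theorem smoothAbs_le₁ (ε r : ℝ) : Real.sqrt (r ^ 2 + ε ^ 2) ≤ |r| + |ε| := by
  rw [Real.sqrt_le_left (by positivity)]
  nlinarith [abs_nonneg r, abs_nonneg ε, sq_abs r, sq_abs ε]

/-- `r⁺ ≤ (r + √(r² + ε²))/2`. [folklore] -/
private theorem posPart_le_smoothPos₁ (ε r : ℝ) : r⁺ ≤ (r + Real.sqrt (r ^ 2 + ε ^ 2)) / 2 := by
  have h := abs_le_smoothAbs₁ ε r
  rw [posPart_eq_ite]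
  split_ifs with hr
  · rw [abs_of_nonneg hr] at h; linarith
  · rw [abs_of_neg (lt_of_not_ge hr)] at h; linarith

/-- `(r + √(r² + ε²))/2 ≤ r⁺ + |ε|/2`. [folklore] -/
private theorem smoothPos_le₁ (ε r : ℝ) : (r + Real.sqrt (r ^ 2 + ε ^ 2)) / 2 ≤ r⁺ + |ε| / 2 := by
  have h := smoothAbs_le₁ ε r
  rw [posPart_eq_ite]
  split_ifs with hr
  · rw [abs_of_nonneg hr] at h; linarith
  · rw [abs_of_neg (lt_of_not_ge hr)] at h; linarith

/-- A weight in `[0, 1]` times `x` is at most `x⁺`. [folklore] -/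
private theorem mul_le_posPart_of_mem_Icc {w : ℝ} (hw : w ∈ Icc (0 : ℝ) 1) (x : ℝ) : w * x ≤ x⁺ := by
  rcases le_or_gt 0 x with hx | hx
  · calc w * x ≤ 1 * x := mul_le_mul_of_nonneg_right hw.2 hx
      _ = x⁺ := by rw [one_mul, posPart_eq_self.2 hx]
  · exact (mul_nonpos_of_nonneg_of_nonpos hw.1 hx.le).trans (posPart_nonneg _)

/-- A weight of modulus `≤ 1` times `x` is at most `|x|`. [folklore] -/
private theorem mul_le_abs_of_abs_le_one {w : ℝ} (hw : |w| ≤ 1) (x : ℝ) : w * x ≤ |x| := by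
  calc w * x ≤ |w * x| := le_abs_self _
    _ = |w| * |x| := abs_mul _ _
    _ ≤ 1 * |x| := mul_le_mul_of_nonneg_right hw (abs_nonneg _)
    _ = |x| := one_mul _

end Approximants

/-! ## Calculus glue: one-sided derivative bounds integrate to differences -/

section Calculus

/-- If `F` has one-sided derivative `F′` within `[a, b]` at every point of `[a, b]`, `F′ ≤ g` on
`[a, b]` and `g` is continuous on `[a, b]`, then `F(t) − F(a) ≤ ∫ₐᵗ g` for `t ∈ [a, b]`
(Mathlib `intervalIntegral.sub_le_integral_of_hasDeriv_right_of_le`). [folklore] -/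
private theorem sub_le_intervalIntegral_of_hasDerivWithinAt_le {F F' g : ℝ → ℝ} {a b t : ℝ}
    (hF : ∀ τ ∈ Icc a b, HasDerivWithinAt F (F' τ) (Icc a b) τ) (hle : ∀ τ ∈ Icc a b, F' τ ≤ g τ)
    (hg : ContinuousOn g (Icc a b)) (ht : t ∈ Icc a b) :
    F t - F a ≤ ∫ τ in a..t, g τ := by
  have hta : Icc a t ⊆ Icc a b := Icc_subset_Icc le_rfl ht.2
  refine intervalIntegral.sub_le_integral_of_hasDeriv_right_of_le ht.1
    (fun τ hτ => ((hF τ (hta hτ)).continuousWithinAt).mono hta)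
    (fun τ hτ => ?_) ((hg.mono hta).integrableOn_Icc) fun τ hτ => hle τ (hta (Ioo_subset_Icc_self hτ))
  exact ((hF τ (hta (Ioo_subset_Icc_self hτ))).hasDerivAt
    (Icc_mem_nhds hτ.1 (hτ.2.trans_le ht.2))).hasDerivWithinAt

/-- If `F` has one-sided derivative `F′` within `[a, b]` at every point of `[a, b]` and `F′` is
continuous on `[a, b]`, then `F(t) − F(a) = ∫ₐᵗ F′` for `t ∈ [a, b]` (fundamental theorem of
calculus). [folklore] -/
private theorem sub_eq_intervalIntegral_of_hasDerivWithinAt {F F' : ℝ → ℝ} {a b t : ℝ}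
    (hF : ∀ τ ∈ Icc a b, HasDerivWithinAt F (F' τ) (Icc a b) τ) (hF' : ContinuousOn F' (Icc a b))
    (ht : t ∈ Icc a b) : F t - F a = ∫ τ in a..t, F' τ := by
  have hta : Icc a t ⊆ Icc a b := Icc_subset_Icc le_rfl ht.2
  exact (intervalIntegral.integral_eq_sub_of_hasDerivAt_of_le ht.1
    (fun τ hτ => ((hF τ (hta hτ)).continuousWithinAt).mono hta)
    (fun τ hτ => (hF τ (hta (Ioo_subset_Icc_self hτ))).hasDerivAt
      (Icc_mem_nhds hτ.1 (hτ.2.trans_le ht.2)))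
    ((hF'.mono hta).intervalIntegrable_of_Icc ht.1)).symm

omit [DecidableEq d] in
/-- Space integrals of a continuous function of a jointly smooth field depend continuously on
time (`Torus.continuousOn_integral_of_continuousOn_stLift`, tube lemma over the compact torus).
[folklore] -/
private theorem continuousOn_integral_comp_of_isSmoothSpaceTimeOn {S : Set ℝ}
    {s : ℝ → UnitAddTorus d → ℝ} (hs : FunctionSpaces.Torus.IsSmoothSpaceTimeOn S s) {φ : ℝ → ℝ}
    (hφ : Continuous φ) : ContinuousOn (fun t => ∫ x, φ (s t x)) S := by
  have h : ContinuousOn (FunctionSpaces.Torus.stLift fun t x => φ (s t x)) (S ×ˢ univ) :=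
    hφ.comp_continuousOn hs.continuousOn_stLift
  exact FunctionSpaces.Torus.continuousOn_integral_of_continuousOn_stLift h

end Calculus

/-! ## The renormalised balance with source and its consequences -/

namespace IsClassicalScalarTransportForcedOn

variable {S S' : Set ℝ} {κ : ℝ} {u : ℝ → UnitAddTorus d → EuclideanSpace ℝ d}
  {s θ : ℝ → UnitAddTorus d → ℝ}

/-- **Restriction of the time set.** A classical forced solution on `S` is one on any subset
`S' ⊆ S` of unique differentiability (the one-sided time derivatives within `S` and within `S'`
agree on `S'`; the equation is DEIJ 2022 (1.1) with a source). [cite: DrivasEtAl2022, (1.1)] -/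
theorem restrict (h : IsClassicalScalarTransportForcedOn S κ u s θ) (hS' : S' ⊆ S)
    (hU : UniqueDiffOn ℝ S') : IsClassicalScalarTransportForcedOn S' κ u s θ where
  smooth_velocity := h.smooth_velocity.mono hS'
  smooth_source := h.smooth_source.mono hS'
  smooth_scalar := h.smooth_scalar.mono hS'
  transport t ht x := by
    have hd : FunctionSpaces.Torus.timeDerivWithin S' θ t x =
        FunctionSpaces.Torus.timeDerivWithin S θ t x :=
      ((h.smooth_scalar.hasDerivWithinAt_slice (hS' ht) x).mono hS').derivWithin (hU t ht)
    rw [hd]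
    exact h.transport t (hS' ht) x
  divFree t ht := h.divFree t (hS' ht)

/-- Restriction to a non-trivial closed interval `[a, b] ⊆ S`, `a < b` (equation DEIJ 2022 (1.1)
with a source). [cite: DrivasEtAl2022, (1.1)] -/
theorem restrict_Icc (h : IsClassicalScalarTransportForcedOn S κ u s θ) {a b : ℝ} (hab : a < b)
    (hS : Icc a b ⊆ S) : IsClassicalScalarTransportForcedOn (Icc a b) κ u s θ :=
  h.restrict hS (uniqueDiffOn_Icc hab)

/-- **Changing the source off the record.** The notion only constrains the source through the
equation on `S × T^d`: a jointly smooth `s'` that agrees with `s` there may replace it (used to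
rewrite the stretching source of a vorticity component in vector form). [cite: DrivasEtAl2022, (1.1)] -/
theorem congr_source (h : IsClassicalScalarTransportForcedOn S κ u s θ) {s' : ℝ → UnitAddTorus d → ℝ}
    (hs' : FunctionSpaces.Torus.IsSmoothSpaceTimeOn S s') (heq : ∀ t ∈ S, ∀ x, s t x = s' t x) :
    IsClassicalScalarTransportForcedOn S κ u s' θ where
  smooth_velocity := h.smooth_velocity
  smooth_source := hs'
  smooth_scalar := h.smooth_scalar
  transport t ht x := by
    rw [← heq t ht x]
    exact h.transport t ht x
  divFree := h.divFree

/-- **Renormalised balance for classical passive scalars with a source.** For a classical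
solution of `∂ₜθ + u·∇θ = κΔθ + s`, `div u = 0`, on a convex time set `S` and a smooth
`β : ℝ → ℝ`, `d/dt ∫ β(θ(t)) = -κ ∫ β″(θ(t))‖∇θ(t)‖² + ∫ β′(θ(t)) s(t)` within `S`
(differentiate under `∫_{T^d}`, chain rule, the equation; `∫ β′(θ)⟪u, ∇θ⟫ = 0` by
incompressibility and `∫ β′(θ)Δθ = -∫ β″(θ)‖∇θ‖²` by Green's identity on `T^d`). The classical
case of the DiPerna–Lions renormalisation for equations with a right-hand side (`β(θ)` solves the
equation with source `β′(θ)s`, integrated over the torus). At an isolated point of `S` the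
statement is vacuous. [cite: DiPernaLions1989Invent, §II.3] -/
theorem hasDerivWithinAt_integral_comp (h : IsClassicalScalarTransportForcedOn S κ u s θ)
    (hS : Convex ℝ S) {β : ℝ → ℝ} (hβ : ContDiff ℝ ∞ β) {t : ℝ} (ht : t ∈ S) :
    HasDerivWithinAt (fun τ => ∫ x, β (θ τ x))
      (-κ * (∫ x, deriv (deriv β) (θ t x) * ‖FunctionSpaces.Torus.gradient (θ t) x‖ ^ 2) +
        ∫ x, deriv β (θ t x) * s t x) S t := by
  by_cases hacc : AccPt t (𝓟 S)
  swap
  · exact HasFDerivWithinAt.of_not_accPt hacc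
  have hU : UniqueDiffOn ℝ S :=
    uniqueDiffOn_convex hS (FunctionSpaces.Torus.interior_nonempty_of_convex_of_accPt hS ht hacc)
  have hθs := h.smooth_scalar
  have hθt : FunctionSpaces.Torus.IsSmooth (θ t) := hθs.isSmooth_slice ht
  have hut : FunctionSpaces.Torus.IsSmooth (u t) := h.smooth_velocity.isSmooth_slice ht
  have hst : FunctionSpaces.Torus.IsSmooth (s t) := h.smooth_source.isSmooth_slice ht
  have hβ' : ContDiff ℝ ∞ (deriv β) := (contDiff_infty_iff_deriv.1 hβ).2
  -- differentiate `∫ β(θ)` under the integral sign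
  have hφ : FunctionSpaces.Torus.IsSmoothSpaceTimeOn S (fun τ x => β (θ τ x)) :=
    hθs.comp_contDiff hβ
  have hE := hφ.hasDerivWithinAt_integral hS ht
  have htd : ∀ x, FunctionSpaces.Torus.timeDerivWithin S (fun τ x => β (θ τ x)) t x =
      deriv β (θ t x) * FunctionSpaces.Torus.timeDerivWithin S θ t x := by
    intro x
    have h1 : HasDerivWithinAt (fun τ => θ τ x) (FunctionSpaces.Torus.timeDerivWithin S θ t x) S t :=
      hθs.hasDerivWithinAt_slice ht x
    have h2 : HasDerivAt β (deriv β (θ t x)) (θ t x) :=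
      ((hβ.differentiable (by simp)) _).hasDerivAt
    have h3 : HasDerivWithinAt (fun τ => β (θ τ x))
        (deriv β (θ t x) * FunctionSpaces.Torus.timeDerivWithin S θ t x) S t :=
      h2.comp_hasDerivWithinAt t h1
    rw [FunctionSpaces.Torus.timeDerivWithin]
    exact h3.derivWithin (hU t ht)
  refine hE.congr_deriv ?_
  -- evaluate `∫ β'(θ) ∂ₜθ` with the equation and the two integrations by parts
  have hpt : (fun x => FunctionSpaces.Torus.timeDerivWithin S (fun τ x => β (θ τ x)) t x) =
      fun x => (κ * (deriv β (θ t x) * FunctionSpaces.Torus.laplacian (θ t) x) -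
        deriv β (θ t x) * ⟪u t x, FunctionSpaces.Torus.gradient (θ t) x⟫_ℝ) +
        deriv β (θ t x) * s t x := by
    funext x
    rw [htd x]
    have := h.transport t ht x
    have hre : FunctionSpaces.Torus.timeDerivWithin S θ t x =
        κ * FunctionSpaces.Torus.laplacian (θ t) x - ⟪u t x, FunctionSpaces.Torus.gradient (θ t) x⟫_ℝ +
          s t x := by
      linarith
    rw [hre]
    ring
  have hβθ : FunctionSpaces.Torus.IsSmooth (deriv β ∘ θ t) := hθt.comp_left hβ'
  have i1 : Integrable (fun x => deriv β (θ t x) * FunctionSpaces.Torus.laplacian (θ t) x) volume :=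
    (hβθ.smul' hθt.laplacian).integrable
  have i2 : Integrable (fun x => deriv β (θ t x) * ⟪u t x, FunctionSpaces.Torus.gradient (θ t) x⟫_ℝ)
      volume :=
    (hβθ.smul' (hut.inner hθt.gradient)).integrable
  have i3 : Integrable (fun x => deriv β (θ t x) * s t x) volume := (hβθ.smul' hst).integrable
  have hdiv : FunctionSpaces.Torus.IsWeaklyDivFree (u t) := fun φ hφ =>
    integral_inner_gradient_eq_zero_of_isDivFree' hut (h.divFree t ht) hφ
  have i12 : Integrable (fun x => κ * (deriv β (θ t x) * FunctionSpaces.Torus.laplacian (θ t) x) -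
      deriv β (θ t x) * ⟪u t x, FunctionSpaces.Torus.gradient (θ t) x⟫_ℝ) volume :=
    (i1.const_mul κ).sub i2
  rw [hpt, integral_add i12 i3, integral_sub (i1.const_mul κ) i2,
    integral_const_mul, integral_deriv_comp_mul_laplacian hβ hθt,
    integral_deriv_comp_mul_inner_gradient_eq_zero hβ hθt hdiv]
  ring

/-- **Mean balance**: `d/dt ∫ θ(t) = ∫ s(t)` within a convex time set — transport and diffusion
conserve the mean, only the source moves it (`β = id` in the renormalised balance; DEIJ 2022 §1
for `s = 0`, tree `IsClassicalScalarTransportOn.hasDerivWithinAt_scalarMean_holds`). [cite: DiPernaLions1989Invent, §II.3] -/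
theorem hasDerivWithinAt_integral (h : IsClassicalScalarTransportForcedOn S κ u s θ)
    (hS : Convex ℝ S) {t : ℝ} (ht : t ∈ S) :
    HasDerivWithinAt (fun τ => ∫ x, θ τ x) (∫ x, s t x) S t := by
  have h1 := h.hasDerivWithinAt_integral_comp hS (β := fun r => r) contDiff_id ht
  have e1 : deriv (fun r : ℝ => r) = fun _ => 1 := by
    funext r; exact (hasDerivAt_id r).deriv
  have e2 : deriv (fun _ : ℝ => (1 : ℝ)) = fun _ => 0 := by
    funext r; exact deriv_const r 1
  rw [e1, e2] at h1
  simpa using h1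

/-- Mean balance in integrated form: `∫ θ(t) − ∫ θ(a) = ∫ₐᵗ ∫ s` for `t ∈ [a, b] ⊆ S`
(fundamental theorem of calculus; `τ ↦ ∫ s(τ)` is continuous). [cite: DiPernaLions1989Invent, §II.3] -/
theorem integral_sub_integral_eq (h : IsClassicalScalarTransportForcedOn S κ u s θ) {a b : ℝ}
    (hS : Icc a b ⊆ S) {t : ℝ} (ht : t ∈ Icc a b) :
    (∫ x, θ t x) - (∫ x, θ a x) = ∫ τ in a..t, ∫ x, s τ x := by
  rcases eq_or_lt_of_le ht.1 with rfl | hat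
  · simp
  have hab : a < b := hat.trans_le ht.2
  have h' := h.restrict_Icc hab hS
  have hcont : ContinuousOn (fun τ => ∫ x, s τ x) (Icc a b) := by
    simpa using continuousOn_integral_comp_of_isSmoothSpaceTimeOn h'.smooth_source continuous_id
  exact sub_eq_intervalIntegral_of_hasDerivWithinAt
    (fun τ hτ => h'.hasDerivWithinAt_integral (convex_Icc a b) hτ) hcont ht

omit [DecidableEq d] in
/-- The renormalised dissipation `∫ β″(θ) ‖∇θ‖²` is nonnegative for convex `β`. [folklore] -/
private theorem integral_deriv_deriv_comp_mul_norm_gradient_sq_nonneg' {β : ℝ → ℝ}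
    (hβ'' : ∀ r, 0 ≤ deriv (deriv β) r) (θ : UnitAddTorus d → ℝ) :
    0 ≤ ∫ x, deriv (deriv β) (θ x) * ‖FunctionSpaces.Torus.gradient θ x‖ ^ 2 :=
  integral_nonneg fun _ => mul_nonneg (hβ'' _) (sq_nonneg _)

/-- **Convex functionals grow at most by the source pairing.** For `κ ≥ 0`, a smooth convex `β`
(`β″ ≥ 0`) and a classical forced solution on `S ⊇ [a, b]`:
`∫ β(θ(t)) − ∫ β(θ(a)) ≤ ∫ₐᵗ ∫ β′(θ(τ)) s(τ) dx dτ` for `t ∈ [a, b]` — the diffusive term of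
the renormalised balance is nonpositive and is dropped (DiPerna–Lions 1989 §II.3 renormalisation,
classical case, integrated in time). [cite: DiPernaLions1989Invent, §II.3] -/
theorem integral_comp_sub_integral_comp_le (h : IsClassicalScalarTransportForcedOn S κ u s θ)
    (hκ : 0 ≤ κ) {β : ℝ → ℝ} (hβ : ContDiff ℝ ∞ β) (hβ'' : ∀ r, 0 ≤ deriv (deriv β) r)
    {a b : ℝ} (hS : Icc a b ⊆ S) {t : ℝ} (ht : t ∈ Icc a b) :
    (∫ x, β (θ t x)) - (∫ x, β (θ a x)) ≤ ∫ τ in a..t, ∫ x, deriv β (θ τ x) * s τ x := by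
  rcases eq_or_lt_of_le ht.1 with rfl | hat
  · simp
  have hab : a < b := hat.trans_le ht.2
  have h' := h.restrict_Icc hab hS
  have hβ' : ContDiff ℝ ∞ (deriv β) := (contDiff_infty_iff_deriv.1 hβ).2
  have hcont : ContinuousOn (fun τ => ∫ x, deriv β (θ τ x) * s τ x) (Icc a b) :=
    ((h'.smooth_scalar.comp_contDiff hβ').mul h'.smooth_source).continuousOn_integral (convex_Icc a b)
  refine sub_le_intervalIntegral_of_hasDerivWithinAt_le
    (fun τ hτ => h'.hasDerivWithinAt_integral_comp (convex_Icc a b) hβ hτ) (fun τ _ => ?_) hcont ht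
  have hD := integral_deriv_deriv_comp_mul_norm_gradient_sq_nonneg' hβ'' (θ τ)
  nlinarith

/-- **The co-signed mass above a level grows at most by the positive part of the source**: for
`κ ≥ 0` and a classical forced solution on `S ⊇ [a, b]`,
`∫ (θ(t) − c)⁺ − ∫ (θ(a) − c)⁺ ≤ ∫ₐᵗ ∫ s⁺` for `t ∈ [a, b]` and every level `c` (apply
`integral_comp_sub_integral_comp_le` to the smooth convex `r ↦ ((r − c) + √((r − c)² + ε²))/2`,
whose derivative lies in `[0, 1]` so that the source pairing is `≤ ∫ s⁺`, and which lies within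
`ε/2` of `(r − c)⁺` uniformly; let `ε → 0`). The unforced case `s = 0` is the monotonicity of
Gallay–Wayne 2005, Lemma 3.1 / the tree's `IsClassicalScalarTransportOn.antitoneOn_integral_posPart_sub`;
with a source it is the classical periodic form of the Crandall–Tartar `L¹`/order estimate for
`∂ₜθ + u·∇θ − κΔθ = s`. [cite: GallayWayne2005, Lemma 3.1] -/
theorem integral_posPart_sub_sub_le (h : IsClassicalScalarTransportForcedOn S κ u s θ) (hκ : 0 ≤ κ)
    (c : ℝ) {a b : ℝ} (hS : Icc a b ⊆ S) {t : ℝ} (ht : t ∈ Icc a b) :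
    (∫ x, (θ t x - c)⁺) - (∫ x, (θ a x - c)⁺) ≤ ∫ τ in a..t, ∫ x, (s τ x)⁺ := by
  rcases eq_or_lt_of_le ht.1 with rfl | hat
  · simp
  have hab : a < b := hat.trans_le ht.2
  have h' := h.restrict_Icc hab hS
  -- continuity of the bound `τ ↦ ∫ s⁺`
  have hg : ContinuousOn (fun τ => ∫ x, (s τ x)⁺) (Icc a b) :=
    continuousOn_integral_comp_of_isSmoothSpaceTimeOn h'.smooth_source continuous_posPart
  -- integrability of the slices
  have hθsm : ∀ τ ∈ Icc a b, FunctionSpaces.Torus.IsSmooth (θ τ) := fun τ hτ =>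
    h'.smooth_scalar.isSmooth_slice hτ
  have hssm : ∀ τ ∈ Icc a b, FunctionSpaces.Torus.IsSmooth (s τ) := fun τ hτ =>
    h'.smooth_source.isSmooth_slice hτ
  refine le_of_forall_pos_le_add fun ε hε => ?_
  set P : ℝ → ℝ := fun r => ((r - c) + Real.sqrt ((r - c) ^ 2 + ε ^ 2)) / 2 with hP
  have hPc : ContDiff ℝ ∞ P := (contDiff_smoothPos₁ hε.ne').comp (contDiff_id.sub contDiff_const)
  have hdP : ∀ r, deriv P r = deriv (fun r => (r + Real.sqrt (r ^ 2 + ε ^ 2)) / 2) (r - c) :=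
    fun r => deriv_comp_sub_const (fun r => (r + Real.sqrt (r ^ 2 + ε ^ 2)) / 2) c r
  have hP'' : ∀ r, 0 ≤ deriv (deriv P) r := by
    intro r
    have hd1 : deriv P = fun r => deriv (fun r => (r + Real.sqrt (r ^ 2 + ε ^ 2)) / 2) (r - c) :=
      funext hdP
    rw [hd1, deriv_comp_sub_const (deriv (fun r => (r + Real.sqrt (r ^ 2 + ε ^ 2)) / 2)) c r]
    exact deriv_deriv_smoothPos_nonneg₁ hε.ne' _
  -- the smooth functional grows at most by `∫ s⁺`
  have hderiv : ∀ τ ∈ Icc a b, HasDerivWithinAt (fun σ => ∫ x, P (θ σ x))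
      (-κ * (∫ x, deriv (deriv P) (θ τ x) * ‖FunctionSpaces.Torus.gradient (θ τ) x‖ ^ 2) +
        ∫ x, deriv P (θ τ x) * s τ x) (Icc a b) τ :=
    fun τ hτ => h'.hasDerivWithinAt_integral_comp (convex_Icc a b) hPc hτ
  have hle : ∀ τ ∈ Icc a b,
      (-κ * (∫ x, deriv (deriv P) (θ τ x) * ‖FunctionSpaces.Torus.gradient (θ τ) x‖ ^ 2) +
        ∫ x, deriv P (θ τ x) * s τ x) ≤ ∫ x, (s τ x)⁺ := by
    intro τ hτ
    have hD := integral_deriv_deriv_comp_mul_norm_gradient_sq_nonneg' hP'' (θ τ)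
    have hPd : Continuous (deriv P) := (hPc.continuous_deriv (by simp))
    have hsrc : (∫ x, deriv P (θ τ x) * s τ x) ≤ ∫ x, (s τ x)⁺ := by
      refine integral_mono (((hPd.comp (hθsm τ hτ).continuous).mul (hssm τ hτ).continuous).integrable_unitAddTorus)
        ((continuous_posPart.comp (hssm τ hτ).continuous).integrable_unitAddTorus) fun x => ?_
      dsimp only
      rw [show deriv P (θ τ x) = deriv (fun r => (r + Real.sqrt (r ^ 2 + ε ^ 2)) / 2) (θ τ x - c)
        from hdP _]
      exact mul_le_posPart_of_mem_Icc (deriv_smoothPos_mem_Icc hε.ne' _) _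
    nlinarith
  have hmain := sub_le_intervalIntegral_of_hasDerivWithinAt_le hderiv hle hg ht
  -- compare with the positive parts
  have hlow : (∫ x, (θ t x - c)⁺) ≤ ∫ x, P (θ t x) :=
    integral_mono_of_nonneg (Eventually.of_forall fun x => posPart_nonneg _)
      ((hPc.continuous.comp (hθsm t ht).continuous).integrable_unitAddTorus)
      (Eventually.of_forall fun x => posPart_le_smoothPos₁ ε _)
  have hup : (∫ x, P (θ a x)) ≤ (∫ x, (θ a x - c)⁺) + ε / 2 := by
    have ha : a ∈ Icc a b := left_mem_Icc.2 hab.le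
    have hint : Integrable (fun x => (θ a x - c)⁺ + |ε| / 2) (volume : Measure (UnitAddTorus d)) :=
      ((continuous_posPart.comp ((hθsm a ha).continuous.sub continuous_const)).integrable_unitAddTorus).add
        (integrable_const _)
    calc (∫ x, P (θ a x)) ≤ ∫ x, ((θ a x - c)⁺ + |ε| / 2) :=
          integral_mono_of_nonneg
            (Eventually.of_forall fun x => (posPart_nonneg _).trans (posPart_le_smoothPos₁ ε _))
            hint (Eventually.of_forall fun x => smoothPos_le₁ ε _)
      _ = (∫ x, (θ a x - c)⁺) + |ε| / 2 := by
          rw [integral_add _ (integrable_const _), integral_const, probReal_univ, one_smul]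
          exact (continuous_posPart.comp ((hθsm a ha).continuous.sub continuous_const)).integrable_unitAddTorus
      _ = (∫ x, (θ a x - c)⁺) + ε / 2 := by rw [abs_of_pos hε]
  linarith

/-- **The co-signed mass `∫ θ⁺` grows at most by `∫∫ s⁺`**: for `κ ≥ 0` on every `[a, b] ⊆ S`,
`∫ θ(t)⁺ − ∫ θ(a)⁺ ≤ ∫ₐᵗ ∫ s⁺` (the case `c = 0` of `integral_posPart_sub_sub_le`). Diffusion
and incompressible transport contribute nothing positive: the co-signed mass is raised only by
co-signed injection. [cite: GallayWayne2005, Lemma 3.1] -/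
theorem integral_posPart_sub_le (h : IsClassicalScalarTransportForcedOn S κ u s θ) (hκ : 0 ≤ κ)
    {a b : ℝ} (hS : Icc a b ⊆ S) {t : ℝ} (ht : t ∈ Icc a b) :
    (∫ x, (θ t x)⁺) - (∫ x, (θ a x)⁺) ≤ ∫ τ in a..t, ∫ x, (s τ x)⁺ := by
  simpa using h.integral_posPart_sub_sub_le hκ 0 hS ht

/-- With a **nonpositive source** (pure absorption, `s ≤ 0` on `[a, b] × T^d`) the co-signed mass
`∫ θ⁺` is non-increasing on `[a, b]` (`∫∫ s⁺ = 0` in `integral_posPart_sub_le`, applied on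
sub-intervals). [cite: GallayWayne2005, Lemma 3.1] -/
theorem antitoneOn_integral_posPart_of_nonpos (h : IsClassicalScalarTransportForcedOn S κ u s θ)
    (hκ : 0 ≤ κ) {a b : ℝ} (hS : Icc a b ⊆ S) (hs : ∀ τ ∈ Icc a b, ∀ x, s τ x ≤ 0) :
    AntitoneOn (fun t => ∫ x, (θ t x)⁺) (Icc a b) := by
  intro t₁ ht₁ t₂ ht₂ h12
  have hsub : Icc t₁ b ⊆ Icc a b := Icc_subset_Icc ht₁.1 le_rfl
  have hmain := h.integral_posPart_sub_le hκ (hsub.trans hS) (t := t₂) ⟨h12, ht₂.2⟩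
  have hzero : ∫ τ in t₁..t₂, ∫ x, (s τ x)⁺ = 0 := by
    rw [← intervalIntegral.integral_zero (a := t₁) (b := t₂)]
    refine intervalIntegral.integral_congr fun τ hτ => ?_
    rw [uIcc_of_le h12] at hτ
    have hτ' : τ ∈ Icc a b := ⟨ht₁.1.trans hτ.1, hτ.2.trans ht₂.2⟩
    have e : (fun x => (s τ x)⁺) = fun _ => 0 := funext fun x => posPart_eq_zero.2 (hs τ hτ' x)
    simp only [e, integral_zero]
  dsimp only
  linarith

/-! ## Linearity: zero, negatives and differences; counter-signed mass, `L¹` norm, `L¹`-stability -/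

omit [DecidableEq d] in
/-- `D(f - g)(x) = Df(x) - Dg(x)` for `C¹` functions on the torus (Mathlib `fderiv_sub` on the
re-centred lifts). [folklore] -/
private theorem fderiv_sub_apply₁ {f g : UnitAddTorus d → ℝ} (hf : FunctionSpaces.Torus.IsContDiff 1 f)
    (hg : FunctionSpaces.Torus.IsContDiff 1 g) (x : UnitAddTorus d) (w : EuclideanSpace ℝ d) :
    FunctionSpaces.Torus.fderiv (fun y => f y - g y) x w =
      FunctionSpaces.Torus.fderiv f x w - FunctionSpaces.Torus.fderiv g x w := by
  unfold FunctionSpaces.Torus.fderiv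
  rw [show FunctionSpaces.Torus.liftAt (fun y => f y - g y) x =
      FunctionSpaces.Torus.liftAt f x - FunctionSpaces.Torus.liftAt g x from rfl,
    _root_.fderiv_sub ((hf.liftAt x).differentiable one_ne_zero).differentiableAt
      ((hg.liftAt x).differentiable one_ne_zero).differentiableAt]
  rfl

omit [DecidableEq d] in
/-- `∇(f - g)(x) = ∇f(x) - ∇g(x)` for `C¹` scalars on the torus. [folklore] -/
private theorem gradient_sub_apply₁ {f g : UnitAddTorus d → ℝ} (hf : FunctionSpaces.Torus.IsContDiff 1 f)
    (hg : FunctionSpaces.Torus.IsContDiff 1 g) (x : UnitAddTorus d) :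
    FunctionSpaces.Torus.gradient (fun y => f y - g y) x =
      FunctionSpaces.Torus.gradient f x - FunctionSpaces.Torus.gradient g x := by
  refine ext_inner_right ℝ fun w => ?_
  rw [inner_sub_left, FunctionSpaces.Torus.inner_gradient_left, FunctionSpaces.Torus.inner_gradient_left,
    FunctionSpaces.Torus.inner_gradient_left, fderiv_sub_apply₁ hf hg]

omit [DecidableEq d] in
/-- `Δ(f - g)(x) = Δf(x) - Δg(x)` for smooth functions on the torus (Mathlib
`ContDiffAt.laplacian_sub` on the re-centred lifts). [folklore] -/
private theorem laplacian_sub_apply₁ {f g : UnitAddTorus d → ℝ} (hf : FunctionSpaces.Torus.IsSmooth f)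
    (hg : FunctionSpaces.Torus.IsSmooth g) (x : UnitAddTorus d) :
    FunctionSpaces.Torus.laplacian (fun y => f y - g y) x =
      FunctionSpaces.Torus.laplacian f x - FunctionSpaces.Torus.laplacian g x := by
  unfold FunctionSpaces.Torus.laplacian
  rw [show FunctionSpaces.Torus.liftAt (fun y => f y - g y) x =
      FunctionSpaces.Torus.liftAt f x - FunctionSpaces.Torus.liftAt g x from rfl]
  rw [((hf.isContDiff (n := 2) (by decide)).liftAt x).contDiffAt.laplacian_sub
    ((hg.isContDiff (n := 2) (by decide)).liftAt x).contDiffAt]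

/-- **Linearity.** The difference of two classical forced solutions with the same drift, on a
time set of unique differentiability, is a classical forced solution with the difference of the
sources (the equation is linear in `(θ, s)`; Gallay–Wayne 2005, proof of Lemma 3.1: "by
construction we have `w = w₁ - w₂`"). [cite: GallayWayne2005, proof of Lemma 3.1] -/
theorem sub_source (hU : UniqueDiffOn ℝ S) {s₁ s₂ θ₁ θ₂ : ℝ → UnitAddTorus d → ℝ}
    (h₁ : IsClassicalScalarTransportForcedOn S κ u s₁ θ₁)
    (h₂ : IsClassicalScalarTransportForcedOn S κ u s₂ θ₂) :
    IsClassicalScalarTransportForcedOn S κ u (fun t x => s₁ t x - s₂ t x)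
      (fun t x => θ₁ t x - θ₂ t x) := by
  refine ⟨h₁.smooth_velocity, h₁.smooth_source.sub h₂.smooth_source,
    h₁.smooth_scalar.sub h₂.smooth_scalar, fun t ht x => ?_, h₁.divFree⟩
  have e₁ := h₁.transport t ht x
  have e₂ := h₂.transport t ht x
  have hθ₁ : FunctionSpaces.Torus.IsSmooth (θ₁ t) := h₁.smooth_scalar.isSmooth_slice ht
  have hθ₂ : FunctionSpaces.Torus.IsSmooth (θ₂ t) := h₂.smooth_scalar.isSmooth_slice ht
  have htd : FunctionSpaces.Torus.timeDerivWithin S (fun t x => θ₁ t x - θ₂ t x) t x =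
      FunctionSpaces.Torus.timeDerivWithin S θ₁ t x - FunctionSpaces.Torus.timeDerivWithin S θ₂ t x := by
    have hd := (h₁.smooth_scalar.hasDerivWithinAt_slice ht x).sub
      (h₂.smooth_scalar.hasDerivWithinAt_slice ht x)
    rw [FunctionSpaces.Torus.timeDerivWithin]
    exact hd.derivWithin (hU t ht)
  rw [htd, gradient_sub_apply₁ (hθ₁.isContDiff (by decide)) (hθ₂.isContDiff (by decide)),
    laplacian_sub_apply₁ hθ₁ hθ₂, inner_sub_right]
  linarith

/-- The zero scalar with zero source is a classical forced solution for any smooth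
divergence-free drift (here: the drift of a given solution; equation DEIJ 2022 (1.1) with a
source, trivially satisfied). [cite: DrivasEtAl2022, (1.1)] -/
theorem zero (h : IsClassicalScalarTransportForcedOn S κ u s θ) :
    IsClassicalScalarTransportForcedOn S κ u (fun _ _ => 0) (fun _ _ => 0) := by
  have h0 : FunctionSpaces.Torus.IsSmoothSpaceTimeOn S (fun (_ : ℝ) (_ : UnitAddTorus d) => (0 : ℝ)) :=
    FunctionSpaces.Torus.isSmoothSpaceTimeOn_const (FunctionSpaces.Torus.isSmooth_const (d := d) (0 : ℝ)) S
  refine ⟨h.smooth_velocity, h0, h0, fun t ht x => ?_, h.divFree⟩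
  have htd : FunctionSpaces.Torus.timeDerivWithin S (fun (_ : ℝ) (_ : UnitAddTorus d) => (0 : ℝ)) t x = 0 := by
    rw [FunctionSpaces.Torus.timeDerivWithin, derivWithin_fun_const]
    rfl
  have hg : FunctionSpaces.Torus.gradient (fun _ : UnitAddTorus d => (0 : ℝ)) x = 0 := by
    unfold FunctionSpaces.Torus.gradient
    rw [show FunctionSpaces.Torus.liftAt (fun _ : UnitAddTorus d => (0 : ℝ)) x =
      fun _ : EuclideanSpace ℝ d => (0 : ℝ) from rfl]
    exact gradient_fun_const _ _
  have hl : FunctionSpaces.Torus.laplacian (fun _ : UnitAddTorus d => (0 : ℝ)) x = 0 := by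
    unfold FunctionSpaces.Torus.laplacian
    rw [show FunctionSpaces.Torus.liftAt (fun _ : UnitAddTorus d => (0 : ℝ)) x =
      fun _ : EuclideanSpace ℝ d => (0 : ℝ) from rfl, InnerProductSpace.laplacian_const]
    rfl
  rw [htd, hg, hl, inner_zero_right]
  ring

/-- **Negatives.** `−θ` is a classical forced solution with source `−s` (time set of unique
differentiability; linearity of the equation, as in Gallay–Wayne 2005, proof of Lemma 3.1).
[cite: GallayWayne2005, proof of Lemma 3.1] -/
theorem neg (hU : UniqueDiffOn ℝ S) (h : IsClassicalScalarTransportForcedOn S κ u s θ) :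
    IsClassicalScalarTransportForcedOn S κ u (fun t x => -s t x) (fun t x => -θ t x) := by
  have h1 := sub_source hU h.zero h
  have es : (fun t x => (fun (_ : ℝ) (_ : UnitAddTorus d) => (0 : ℝ)) t x - s t x) = fun t x => -s t x := by
    funext t x; ring
  have eθ : (fun t x => (fun (_ : ℝ) (_ : UnitAddTorus d) => (0 : ℝ)) t x - θ t x) = fun t x => -θ t x := by
    funext t x; ring
  rw [es, eθ] at h1
  exact h1

/-- **The counter-signed mass `∫ θ⁻` grows at most by `∫∫ s⁻`**: for `κ ≥ 0` on every
`[a, b] ⊆ S`, `∫ θ(t)⁻ − ∫ θ(a)⁻ ≤ ∫ₐᵗ ∫ s⁻` (`integral_posPart_sub_le` for `−θ`, a solution with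
source `−s`). With `integral_posPart_sub_le`: transport and diffusion only CANCEL the two signed
masses against each other; each is raised only by injection of its own sign (Gallay–Wayne 2005,
proof of Lemma 3.1, the unforced case on `ℝ²`). [cite: GallayWayne2005, Lemma 3.1] -/
theorem integral_negPart_sub_le (h : IsClassicalScalarTransportForcedOn S κ u s θ) (hκ : 0 ≤ κ)
    {a b : ℝ} (hS : Icc a b ⊆ S) {t : ℝ} (ht : t ∈ Icc a b) :
    (∫ x, (θ t x)⁻) - (∫ x, (θ a x)⁻) ≤ ∫ τ in a..t, ∫ x, (s τ x)⁻ := by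
  rcases eq_or_lt_of_le ht.1 with rfl | hat
  · simp
  have hab : a < b := hat.trans_le ht.2
  have h' := (h.restrict_Icc hab hS).neg (uniqueDiffOn_Icc hab)
  have hmain := h'.integral_posPart_sub_le hκ Subset.rfl ht
  simp only [posPart_neg] at hmain
  exact hmain

/-- **The `L¹` norm `∫ |θ|` grows at most by `∫∫ |s|`**: for `κ ≥ 0` on every `[a, b] ⊆ S`,
`∫ |θ(t)| − ∫ |θ(a)| ≤ ∫ₐᵗ ∫ |s|` (`|r| = r⁺ + r⁻` and the two signed estimates). The unforced
case is Gallay–Wayne 2005, Lemma 3.1 ("the `L¹` norm is nonincreasing due to the maximum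
principle", there on `ℝ²`; tree `IsClassicalScalarTransportOn.antitoneOn_integral_abs`).
[cite: GallayWayne2005, Lemma 3.1] -/
theorem integral_abs_sub_le (h : IsClassicalScalarTransportForcedOn S κ u s θ) (hκ : 0 ≤ κ)
    {a b : ℝ} (hS : Icc a b ⊆ S) {t : ℝ} (ht : t ∈ Icc a b) :
    (∫ x, |θ t x|) - (∫ x, |θ a x|) ≤ ∫ τ in a..t, ∫ x, |s τ x| := by
  rcases eq_or_lt_of_le ht.1 with rfl | hat
  · simp
  have hab : a < b := hat.trans_le ht.2
  have h' := h.restrict_Icc hab hS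
  have hp := h'.integral_posPart_sub_le hκ Subset.rfl ht
  have hn := h'.integral_negPart_sub_le hκ Subset.rfl ht
  have hθsm : ∀ τ ∈ Icc a b, FunctionSpaces.Torus.IsSmooth (θ τ) := fun τ hτ =>
    h'.smooth_scalar.isSmooth_slice hτ
  have hssm : ∀ τ ∈ Icc a b, FunctionSpaces.Torus.IsSmooth (s τ) := fun τ hτ =>
    h'.smooth_source.isSmooth_slice hτ
  have ha : a ∈ Icc a b := left_mem_Icc.2 hab.le
  -- `∫ |θ| = ∫ θ⁺ + ∫ θ⁻` on the slices
  have habs : ∀ τ ∈ Icc a b, (∫ x, |θ τ x|) = (∫ x, (θ τ x)⁺) + ∫ x, (θ τ x)⁻ := by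
    intro τ hτ
    have hc := (hθsm τ hτ).continuous
    have ip : Integrable (fun x => (θ τ x)⁺) (volume : Measure (UnitAddTorus d)) :=
      (continuous_posPart.comp hc).integrable_unitAddTorus
    have ine : Integrable (fun x => (θ τ x)⁻) (volume : Measure (UnitAddTorus d)) :=
      (continuous_negPart.comp hc).integrable_unitAddTorus
    rw [← integral_add ip ine]
    exact integral_congr_ae (Eventually.of_forall fun x => (posPart_add_negPart (θ τ x)).symm)
  -- `∫∫ |s| = ∫∫ s⁺ + ∫∫ s⁻`
  have hsabs : ∫ τ in a..t, ∫ x, |s τ x| =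
      (∫ τ in a..t, ∫ x, (s τ x)⁺) + ∫ τ in a..t, ∫ x, (s τ x)⁻ := by
    have hta : Icc a t ⊆ Icc a b := Icc_subset_Icc le_rfl ht.2
    have cp : ContinuousOn (fun τ => ∫ x, (s τ x)⁺) (Icc a b) :=
      continuousOn_integral_comp_of_isSmoothSpaceTimeOn h'.smooth_source continuous_posPart
    have cn : ContinuousOn (fun τ => ∫ x, (s τ x)⁻) (Icc a b) :=
      continuousOn_integral_comp_of_isSmoothSpaceTimeOn h'.smooth_source continuous_negPart
    rw [← intervalIntegral.integral_add ((cp.mono hta).intervalIntegrable_of_Icc ht.1)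
      ((cn.mono hta).intervalIntegrable_of_Icc ht.1)]
    refine intervalIntegral.integral_congr fun τ hτ => ?_
    rw [uIcc_of_le ht.1] at hτ
    have hc := (hssm τ (hta hτ)).continuous
    have ip : Integrable (fun x => (s τ x)⁺) (volume : Measure (UnitAddTorus d)) :=
      (continuous_posPart.comp hc).integrable_unitAddTorus
    have ine : Integrable (fun x => (s τ x)⁻) (volume : Measure (UnitAddTorus d)) :=
      (continuous_negPart.comp hc).integrable_unitAddTorus
    rw [← integral_add ip ine]
    exact integral_congr_ae (Eventually.of_forall fun x => (posPart_add_negPart (s τ x)).symm)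
  rw [habs t ht, habs a ha, hsabs]
  linarith

/-- **`L¹`-stability with respect to the source.** For two classical forced solutions `θ₁, θ₂`
with the same divergence-free drift and `κ ≥ 0` on `S ⊇ [a, b]`:
`∫ |θ₁(t) − θ₂(t)| − ∫ |θ₁(a) − θ₂(a)| ≤ ∫ₐᵗ ∫ |s₁ − s₂|` (`integral_abs_sub_le` for the
difference, a solution by linearity) — the `L¹`-contraction / order-preservation pairing of
Crandall–Tartar 1980, Prop. 1, for the solution map of `∂ₜθ + u·∇θ − κΔθ = s`, classical
periodic case; equal sources give the contraction of the tree's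
`IsClassicalScalarTransportOn.antitoneOn_integral_abs_sub`. [cite: CrandallTartar1980, Prop. 1] -/
theorem integral_abs_sub_sub_le {s₁ s₂ θ₁ θ₂ : ℝ → UnitAddTorus d → ℝ}
    (h₁ : IsClassicalScalarTransportForcedOn S κ u s₁ θ₁)
    (h₂ : IsClassicalScalarTransportForcedOn S κ u s₂ θ₂) (hκ : 0 ≤ κ) {a b : ℝ}
    (hS : Icc a b ⊆ S) {t : ℝ} (ht : t ∈ Icc a b) :
    (∫ x, |θ₁ t x - θ₂ t x|) - (∫ x, |θ₁ a x - θ₂ a x|) ≤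
      ∫ τ in a..t, ∫ x, |s₁ τ x - s₂ τ x| := by
  rcases eq_or_lt_of_le ht.1 with rfl | hat
  · simp
  have hab : a < b := hat.trans_le ht.2
  exact (sub_source (uniqueDiffOn_Icc hab) (h₁.restrict_Icc hab hS) (h₂.restrict_Icc hab hS)).integral_abs_sub_le
    hκ Subset.rfl ht

/-! ## The co-signed mass is raised only by the source acting WHERE the scalar is positive:
`∫ (θ(t) − c)⁺ − ∫ (θ(a) − c)⁺ ≤ ∫ₐᵗ ∫_{θ > c} s` -/

/-! ### Approximants with exact one-sided limit: `P_δ(w) = ∫₀ʷ smoothTransition (r/δ) dr`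
(`P_δ' = smoothTransition (·/δ) ∈ [0, 1]` tends to `1_{(0,∞)}` EVERYWHERE as `δ → 0`, whereas the
derivative of `(r + √(r² + ε²))/2` tends to `½` at `r = 0`) -/

/-- `P_δ'(w) = smoothTransition (w/δ)`. [folklore] -/
private theorem hasDerivAt_posApproxT (δ w : ℝ) :
    HasDerivAt (fun w => ∫ r in (0 : ℝ)..w, Real.smoothTransition (r / δ))
      (Real.smoothTransition (w / δ)) w := by
  have hc : Continuous fun r : ℝ => Real.smoothTransition (r / δ) :=
    Real.smoothTransition.continuous.comp (continuous_id.div_const δ)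
  exact intervalIntegral.integral_hasDerivAt_right (hc.intervalIntegrable _ _)
    (hc.stronglyMeasurableAtFilter _ _) hc.continuousAt

/-- `deriv P_δ = smoothTransition (·/δ)`. [folklore] -/
private theorem deriv_posApproxT (δ : ℝ) :
    deriv (fun w => ∫ r in (0 : ℝ)..w, Real.smoothTransition (r / δ)) =
      fun w => Real.smoothTransition (w / δ) :=
  funext fun w => (hasDerivAt_posApproxT δ w).deriv

/-- `P_δ ∈ C^∞`. [folklore] -/
private theorem contDiff_posApproxT (δ : ℝ) :
    ContDiff ℝ ∞ fun w => ∫ r in (0 : ℝ)..w, Real.smoothTransition (r / δ) := by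
  rw [contDiff_infty_iff_deriv, deriv_posApproxT]
  exact ⟨fun w => (hasDerivAt_posApproxT δ w).differentiableAt,
    Real.smoothTransition.contDiff.comp (contDiff_id.div_const δ)⟩

/-- `0 ≤ P_δ''` for `δ > 0` (`smoothTransition` is monotone). [folklore] -/
private theorem deriv_deriv_posApproxT_nonneg {δ : ℝ} (hδ : 0 < δ) (w : ℝ) :
    0 ≤ deriv (deriv fun w => ∫ r in (0 : ℝ)..w, Real.smoothTransition (r / δ)) w := by
  rw [deriv_posApproxT]
  have hd : Differentiable ℝ Real.smoothTransition :=
    (Real.smoothTransition.contDiff (n := 1)).differentiable (by norm_num)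
  have h1 : HasDerivAt Real.smoothTransition (deriv Real.smoothTransition (w / δ)) (w / δ) :=
    (hd (w / δ)).hasDerivAt
  have h2 := h1.comp w ((hasDerivAt_id w).div_const δ)
  have h : HasDerivAt (fun w => Real.smoothTransition (w / δ))
      (deriv Real.smoothTransition (w / δ) * (1 / δ)) w := h2
  rw [h.deriv]
  exact mul_nonneg Real.smoothTransition.monotone.deriv_nonneg (by positivity)

/-- `P_δ(w) = 0` for `w ≤ 0`. [folklore] -/
private theorem posApproxT_of_nonpos {δ : ℝ} (hδ : 0 < δ) {w : ℝ} (hw : w ≤ 0) :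
    (∫ r in (0 : ℝ)..w, Real.smoothTransition (r / δ)) = 0 := by
  rw [intervalIntegral.integral_symm]
  have : (∫ r in w..(0 : ℝ), Real.smoothTransition (r / δ)) = ∫ _ in w..(0 : ℝ), (0 : ℝ) := by
    refine intervalIntegral.integral_congr fun r hr => ?_
    rw [uIcc_of_le hw] at hr
    exact Real.smoothTransition.zero_of_nonpos (div_nonpos_of_nonpos_of_nonneg hr.2 hδ.le)
  rw [this, intervalIntegral.integral_zero, neg_zero]

/-- `P_δ(w) ≤ w⁺`. [folklore] -/
private theorem posApproxT_le_posPart {δ : ℝ} (hδ : 0 < δ) (w : ℝ) :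
    (∫ r in (0 : ℝ)..w, Real.smoothTransition (r / δ)) ≤ w⁺ := by
  rcases le_or_gt w 0 with hw | hw
  · rw [posApproxT_of_nonpos hδ hw]; exact posPart_nonneg _
  · have hc : Continuous fun r : ℝ => Real.smoothTransition (r / δ) :=
      Real.smoothTransition.continuous.comp (continuous_id.div_const δ)
    have h1 : (∫ r in (0 : ℝ)..w, Real.smoothTransition (r / δ)) ≤ ∫ _ in (0 : ℝ)..w, (1 : ℝ) :=
      intervalIntegral.integral_mono_on hw.le (hc.intervalIntegrable _ _)
        (continuous_const.intervalIntegrable _ _) fun r _ => Real.smoothTransition.le_one _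
    rw [intervalIntegral.integral_const, smul_eq_mul, mul_one, sub_zero] at h1
    exact h1.trans (le_posPart w)

/-- `w⁺ − δ ≤ P_δ(w)` (the integrand is `≥ 0`, and `= 1` on `[δ, ∞)`). [folklore] -/
private theorem posPart_sub_le_posApproxT {δ : ℝ} (hδ : 0 < δ) (w : ℝ) :
    w⁺ - δ ≤ ∫ r in (0 : ℝ)..w, Real.smoothTransition (r / δ) := by
  have hc : Continuous fun r : ℝ => Real.smoothTransition (r / δ) :=
    Real.smoothTransition.continuous.comp (continuous_id.div_const δ)
  rcases le_or_gt w 0 with hw | hw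
  · rw [posApproxT_of_nonpos hδ hw, posPart_eq_zero.2 hw]; linarith
  rw [posPart_eq_self.2 hw.le]
  rcases le_or_gt w δ with hwδ | hwδ
  · have h0 : 0 ≤ ∫ r in (0 : ℝ)..w, Real.smoothTransition (r / δ) :=
      intervalIntegral.integral_nonneg hw.le fun r _ => Real.smoothTransition.nonneg _
    linarith
  · rw [← intervalIntegral.integral_add_adjacent_intervals (b := δ) (hc.intervalIntegrable _ _)
      (hc.intervalIntegrable _ _)]
    have h0 : 0 ≤ ∫ r in (0 : ℝ)..δ, Real.smoothTransition (r / δ) :=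
      intervalIntegral.integral_nonneg hδ.le fun r _ => Real.smoothTransition.nonneg _
    have h1 : (∫ r in δ..w, Real.smoothTransition (r / δ)) = ∫ _ in δ..w, (1 : ℝ) := by
      refine intervalIntegral.integral_congr fun r hr => ?_
      rw [uIcc_of_le hwδ.le] at hr
      exact Real.smoothTransition.one_of_one_le ((one_le_div hδ).2 hr.1)
    rw [h1, intervalIntegral.integral_const, smul_eq_mul, mul_one]
    linarith

/-- **The co-signed mass above a level is raised only by the source acting where `θ > c`.** For
`κ ≥ 0`, a classical forced solution on `S ⊇ [a, b]`, every level `c` and `t ∈ [a, b]`: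
`∫ (θ(t) − c)⁺ − ∫ (θ(a) − c)⁺ ≤ ∫ₐᵗ ∫_{x : θ(τ, x) > c} s(τ, x) dx dτ` — the SIGNED source,
integrated only over the super-level set (sharpening `integral_posPart_sub_sub_le`, whose bound is
`∫ₐᵗ∫ s⁺` over the whole torus). Proof: `integral_comp_sub_integral_comp_le` for the smooth convex
`P_δ(· − c)` (`P_δ' = smoothTransition((· − c)/δ) ∈ [0, 1]`, `|P_δ − (· − c)⁺| ≤ δ`), then
`δ → 0`: `P_δ'(θ) s → 1_{θ > c} s` pointwise, dominated by `|s|` (dominated convergence in `x` and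
in `τ`). The classical periodic case of the Crandall–Tartar / Kružkov order estimate, in its
localised form. [cite: GallayWayne2005, Lemma 3.1; DiPernaLions1989Invent, §II.3] -/
theorem integral_posPart_sub_sub_le_setIntegral (h : IsClassicalScalarTransportForcedOn S κ u s θ)
    (hκ : 0 ≤ κ) (c : ℝ) {a b : ℝ} (hS : Icc a b ⊆ S) {t : ℝ} (ht : t ∈ Icc a b) :
    (∫ x, (θ t x - c)⁺) - (∫ x, (θ a x - c)⁺) ≤
      ∫ τ in a..t, ∫ x in {x | c < θ τ x}, s τ x := by
  rcases eq_or_lt_of_le ht.1 with rfl | hat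
  · simp
  have hab : a < b := hat.trans_le ht.2
  have h' := h.restrict_Icc hab hS
  have hθsm : ∀ τ ∈ Icc a b, FunctionSpaces.Torus.IsSmooth (θ τ) := fun τ hτ =>
    h'.smooth_scalar.isSmooth_slice hτ
  have hssm : ∀ τ ∈ Icc a b, FunctionSpaces.Torus.IsSmooth (s τ) := fun τ hτ =>
    h'.smooth_source.isSmooth_slice hτ
  -- a uniform bound of the source on the compact slab
  obtain ⟨Cs, hCs⟩ := h'.smooth_source.exists_norm_le_of_isCompact isCompact_Icc Subset.rfl
  -- the approximants `Pₙ(r) = P_{δₙ}(r − c)`, `δₙ = 1/(n+1)`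
  set δs : ℕ → ℝ := fun n => (1 : ℝ) / (n + 1) with hδs
  have hδpos : ∀ n, 0 < δs n := fun n => by rw [hδs]; positivity
  set P : ℕ → ℝ → ℝ := fun n r => ∫ ρ in (0 : ℝ)..(r - c), Real.smoothTransition (ρ / δs n) with hP
  have hPc : ∀ n, ContDiff ℝ ∞ (P n) := fun n =>
    (contDiff_posApproxT (δs n)).comp (contDiff_id.sub contDiff_const)
  have hdP : ∀ n r, deriv (P n) r = Real.smoothTransition ((r - c) / δs n) := by
    intro n r
    have e : deriv (P n) r = deriv (fun w => ∫ ρ in (0 : ℝ)..w, Real.smoothTransition (ρ / δs n)) (r - c) :=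
      deriv_comp_sub_const (fun w => ∫ ρ in (0 : ℝ)..w, Real.smoothTransition (ρ / δs n)) c r
    rw [e, deriv_posApproxT]
  have hP01 : ∀ n r, deriv (P n) r ∈ Icc (0 : ℝ) 1 := fun n r => by
    rw [hdP]; exact ⟨Real.smoothTransition.nonneg _, Real.smoothTransition.le_one _⟩
  have hP'' : ∀ n r, 0 ≤ deriv (deriv (P n)) r := by
    intro n r
    have hd1 : deriv (P n) = fun r =>
        deriv (fun w => ∫ ρ in (0 : ℝ)..w, Real.smoothTransition (ρ / δs n)) (r - c) :=
      funext fun r => deriv_comp_sub_const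
        (fun w => ∫ ρ in (0 : ℝ)..w, Real.smoothTransition (ρ / δs n)) c r
    rw [hd1, deriv_comp_sub_const
      (deriv fun w => ∫ ρ in (0 : ℝ)..w, Real.smoothTransition (ρ / δs n)) c r]
    exact deriv_deriv_posApproxT_nonneg (hδpos n) _
  have hPd' : ∀ n, ContDiff ℝ ∞ (deriv (P n)) := fun n => (contDiff_infty_iff_deriv.1 (hPc n)).2
  -- the majorants `gₙ(τ) = ∫ Pₙ'(θ) s` and their continuity in `τ`
  set g : ℕ → ℝ → ℝ := fun n τ => ∫ x, deriv (P n) (θ τ x) * s τ x with hg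
  have hgcont : ∀ n, ContinuousOn (g n) (Icc a b) := fun n =>
    ((h'.smooth_scalar.comp_contDiff (hPd' n)).mul h'.smooth_source).continuousOn_integral
      (convex_Icc a b)
  -- for each `n`: `∫ Pₙ(θ t) − ∫ Pₙ(θ a) ≤ ∫ₐᵗ gₙ` (diffusion dropped)
  have hstep : ∀ n, (∫ x, P n (θ t x)) - (∫ x, P n (θ a x)) ≤ ∫ τ in a..t, g n τ := by
    intro n
    refine sub_le_intervalIntegral_of_hasDerivWithinAt_le
      (fun τ hτ => h'.hasDerivWithinAt_integral_comp (convex_Icc a b) (hPc n) hτ)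
      (fun τ _ => ?_) (hgcont n) ht
    have hD := integral_deriv_deriv_comp_mul_norm_gradient_sq_nonneg' (hP'' n) (θ τ)
    show -κ * (∫ x, deriv (deriv (P n)) (θ τ x) * ‖FunctionSpaces.Torus.gradient (θ τ) x‖ ^ 2) +
        (∫ x, deriv (P n) (θ τ x) * s τ x) ≤ g n τ
    have e : g n τ = ∫ x, deriv (P n) (θ τ x) * s τ x := rfl
    rw [e]
    nlinarith
  -- comparison with the positive parts: `(r − c)⁺ ≤ Pₙ(r) + δₙ`, `Pₙ(r) ≤ (r − c)⁺`
  have ha : a ∈ Icc a b := left_mem_Icc.2 hab.le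
  have hcmp : ∀ n, (∫ x, (θ t x - c)⁺) - (∫ x, (θ a x - c)⁺) ≤ δs n + ∫ τ in a..t, g n τ := by
    intro n
    have iP : ∀ τ ∈ Icc a b, Integrable (fun x => P n (θ τ x)) (volume : Measure (UnitAddTorus d)) :=
      fun τ hτ => ((hPc n).continuous.comp (hθsm τ hτ).continuous).integrable_unitAddTorus
    have h1 : (∫ x, (θ t x - c)⁺) ≤ (∫ x, P n (θ t x)) + δs n := by
      calc (∫ x, (θ t x - c)⁺) ≤ ∫ x, (P n (θ t x) + δs n) :=
            integral_mono ((continuous_posPart.comp ((hθsm t ht).continuous.sub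
              continuous_const)).integrable_unitAddTorus) ((iP t ht).add (integrable_const _))
              fun x => by
                have := posPart_sub_le_posApproxT (hδpos n) (θ t x - c)
                show (θ t x - c)⁺ ≤ P n (θ t x) + δs n
                linarith
        _ = (∫ x, P n (θ t x)) + δs n := by
            rw [integral_add (iP t ht) (integrable_const _), integral_const, probReal_univ, one_smul]
    have h2 : (∫ x, P n (θ a x)) ≤ ∫ x, (θ a x - c)⁺ :=
      integral_mono (iP a ha) ((continuous_posPart.comp ((hθsm a ha).continuous.sub
        continuous_const)).integrable_unitAddTorus) fun x => posApproxT_le_posPart (hδpos n) _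
    linarith [hstep n]
  -- `gₙ(τ) → ∫_{θ(τ) > c} s(τ)` for `τ ∈ [a, b]` (dominated convergence in `x`)
  have hlimτ : ∀ τ ∈ Icc a b,
      Tendsto (fun n => g n τ) atTop (𝓝 (∫ x in {x | c < θ τ x}, s τ x)) := by
    intro τ hτ
    have hθc := (hθsm τ hτ).continuous
    have hsc := (hssm τ hτ).continuous
    have hSm : MeasurableSet {x | c < θ τ x} := measurableSet_lt measurable_const hθc.measurable
    rw [← integral_indicator hSm]
    show Tendsto (fun n => ∫ x, deriv (P n) (θ τ x) * s τ x) atTop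
      (𝓝 (∫ x, {x | c < θ τ x}.indicator (s τ) x))
    refine tendsto_integral_of_dominated_convergence (fun x => ‖s τ x‖) (fun n => ?_)
      hsc.integrable_unitAddTorus.norm (fun n => ae_of_all _ fun x => ?_) (ae_of_all _ fun x => ?_)
    · exact (((hPd' n).continuous.comp hθc).mul hsc).aestronglyMeasurable
    · rw [norm_mul, Real.norm_eq_abs, abs_of_nonneg (hP01 n _).1]
      exact mul_le_of_le_one_left (norm_nonneg _) (hP01 n _).2
    · by_cases hw : c < θ τ x
      · rw [indicator_of_mem (show x ∈ {x | c < θ τ x} from hw)]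
        refine tendsto_const_nhds.congr' ?_
        have hw' : 0 < θ τ x - c := sub_pos.2 hw
        obtain ⟨N, hN⟩ := exists_nat_gt (1 / (θ τ x - c))
        refine (eventually_ge_atTop N).mono fun n hn => ?_
        show s τ x = deriv (P n) (θ τ x) * s τ x
        have h1 : 1 ≤ (θ τ x - c) / δs n := by
          rw [hδs]
          simp only [one_div, div_inv_eq_mul]
          have hN' : 1 / (θ τ x - c) < (n : ℝ) + 1 :=
            hN.trans_le (by exact_mod_cast Nat.le_succ_of_le hn)
          rw [div_lt_iff₀ hw'] at hN'
          linarith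
        rw [hdP, Real.smoothTransition.one_of_one_le h1, one_mul]
      · rw [indicator_of_notMem (show x ∉ {x | c < θ τ x} from hw)]
        refine tendsto_const_nhds.congr' (Eventually.of_forall fun n => ?_)
        show (0 : ℝ) = deriv (P n) (θ τ x) * s τ x
        rw [hdP, Real.smoothTransition.zero_of_nonpos
          (div_nonpos_of_nonpos_of_nonneg (sub_nonpos.2 (not_lt.1 hw)) (hδpos n).le), zero_mul]
  -- `∫ₐᵗ gₙ → ∫ₐᵗ ∫_{θ > c} s` (dominated convergence in `τ`, constant bound)
  have hlim : Tendsto (fun n => δs n + ∫ τ in a..t, g n τ) atTop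
      (𝓝 (0 + ∫ τ in a..t, ∫ x in {x | c < θ τ x}, s τ x)) := by
    refine tendsto_one_div_add_atTop_nhds_zero_nat.add ?_
    have hIoc : Ioc a t ⊆ Icc a b := Ioc_subset_Icc_self.trans (Icc_subset_Icc le_rfl ht.2)
    refine intervalIntegral.tendsto_integral_filter_of_dominated_convergence (fun _ => Cs)
      (Eventually.of_forall fun n => ?_) (Eventually.of_forall fun n => ae_of_all _ fun τ hτ => ?_)
      intervalIntegrable_const (ae_of_all _ fun τ hτ => ?_)
    · rw [uIoc_of_le ht.1]
      exact ((hgcont n).mono hIoc).aestronglyMeasurable measurableSet_Ioc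
    · rw [uIoc_of_le ht.1] at hτ
      have hτI : τ ∈ Icc a b := hIoc hτ
      show ‖∫ x, deriv (P n) (θ τ x) * s τ x‖ ≤ Cs
      have hb : ∀ᵐ x ∂(volume : Measure (UnitAddTorus d)), ‖deriv (P n) (θ τ x) * s τ x‖ ≤ Cs :=
        ae_of_all _ fun x => by
          rw [norm_mul, Real.norm_eq_abs, abs_of_nonneg (hP01 n _).1]
          exact (mul_le_of_le_one_left (norm_nonneg _) (hP01 n _).2).trans (hCs τ hτI x)
      have := norm_integral_le_of_norm_le_const hb
      rwa [probReal_univ, mul_one] at this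
    · rw [uIoc_of_le ht.1] at hτ
      exact hlimτ τ (hIoc hτ)
  rw [zero_add] at hlim
  exact ge_of_tendsto' hlim hcmp

/-- **The co-signed mass is raised only by the source acting on `{θ > 0}`**:
`∫ θ(t)⁺ − ∫ θ(a)⁺ ≤ ∫ₐᵗ ∫_{θ(τ) > 0} s(τ)` for `κ ≥ 0` on every `[a, b] ⊆ S` (the case `c = 0`).
Transport and diffusion contribute nothing positive, and the source counts WITH ITS SIGN and only
where the scalar is already positive. [cite: GallayWayne2005, Lemma 3.1; DiPernaLions1989Invent, §II.3] -/
theorem integral_posPart_sub_le_setIntegral (h : IsClassicalScalarTransportForcedOn S κ u s θ)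
    (hκ : 0 ≤ κ) {a b : ℝ} (hS : Icc a b ⊆ S) {t : ℝ} (ht : t ∈ Icc a b) :
    (∫ x, (θ t x)⁺) - (∫ x, (θ a x)⁺) ≤ ∫ τ in a..t, ∫ x in {x | 0 < θ τ x}, s τ x := by
  simpa using h.integral_posPart_sub_sub_le_setIntegral hκ 0 hS ht

/-- **A positive era is source-signed**: if `θ(τ, ·) > 0` a.e. for every `τ ∈ [a, b]`, then
`∫ θ(t)⁺ − ∫ θ(a)⁺ ≤ ∫ₐᵗ ∫ s` — the full signed space mean of the source (no positive part).
[cite: GallayWayne2005, Lemma 3.1; DiPernaLions1989Invent, §II.3] -/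
theorem integral_posPart_sub_le_of_ae_pos (h : IsClassicalScalarTransportForcedOn S κ u s θ)
    (hκ : 0 ≤ κ) {a b : ℝ} (hS : Icc a b ⊆ S) {t : ℝ} (ht : t ∈ Icc a b)
    (hpos : ∀ τ ∈ Icc a b, ∀ᵐ x ∂(volume : Measure (UnitAddTorus d)), 0 < θ τ x) :
    (∫ x, (θ t x)⁺) - (∫ x, (θ a x)⁺) ≤ ∫ τ in a..t, ∫ x, s τ x := by
  have hmain := h.integral_posPart_sub_le_setIntegral hκ hS ht
  have e : (∫ τ in a..t, ∫ x in {x | 0 < θ τ x}, s τ x) = ∫ τ in a..t, ∫ x, s τ x := by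
    refine intervalIntegral.integral_congr fun τ hτ => ?_
    rw [uIcc_of_le ht.1] at hτ
    have hτ' : τ ∈ Icc a b := ⟨hτ.1, hτ.2.trans ht.2⟩
    have hSet : ∀ᵐ x ∂(volume : Measure (UnitAddTorus d)), x ∈ {x | 0 < θ τ x} := hpos τ hτ'
    show (∫ x in {x | 0 < θ τ x}, s τ x) = ∫ x, s τ x
    rw [Measure.restrict_eq_self_of_ae_mem hSet]
  rw [e] at hmain
  exact hmain


end IsClassicalScalarTransportForcedOn

/-! ## Smeared Gauss–Green on a super-level set: the integral of a divergence over `{θ > 0}` is a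
thin-band flux through the nodal set `{θ = 0}`

For smooth `θ` and a smooth vector field `F = (Fₖ)` on `T^d`, with the approximate indicators
`gₙ(r) = smoothTransition((n+1) r)` (`gₙ ∈ [0, 1]`, `gₙ → 1_{(0,∞)}` everywhere, `gₙ' ≥ 0`
supported in the band `0 ≤ r ≤ 1/(n+1)`): `∫ gₙ'(θ) ∑ₖ ∂ₖθ Fₖ = −∫ gₙ(θ) ∑ₖ ∂ₖFₖ → −∫_{θ>0} div F`.
When `0` is a regular value of `θ` the left-hand side tends to the boundary flux
`−∫_{θ=0} F·∇θ/|∇θ| dσ` and this is the Gauss–Green theorem for `U = {θ > 0}` (Evans, App. C.2,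
Thm. 1); the smeared form needs no regularity of the level set. -/

section SuperlevelFlux

/-- The approximate indicators `gₙ(r) = smoothTransition((n+1) r)` are smooth. [folklore] -/
private theorem contDiff_approxIndicator (n : ℕ) :
    ContDiff ℝ ∞ fun r : ℝ => Real.smoothTransition (((n : ℝ) + 1) * r) :=
  Real.smoothTransition.contDiff.comp (contDiff_const.mul contDiff_id)

/-- `gₙ(r) ∈ [0, 1]`. [folklore] -/
private theorem approxIndicator_mem_Icc (n : ℕ) (r : ℝ) :
    Real.smoothTransition (((n : ℝ) + 1) * r) ∈ Icc (0 : ℝ) 1 :=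
  ⟨Real.smoothTransition.nonneg _, Real.smoothTransition.le_one _⟩

/-- `gₙ(r) → 1_{r > 0}` for every `r` (exactly: `= 1` eventually for `r > 0`, `= 0` for `r ≤ 0`).
[folklore] -/
private theorem tendsto_approxIndicator (r : ℝ) :
    Tendsto (fun n : ℕ => Real.smoothTransition (((n : ℝ) + 1) * r)) atTop
      (𝓝 (if 0 < r then 1 else 0)) := by
  by_cases hr : 0 < r
  · rw [if_pos hr]
    refine tendsto_const_nhds.congr' ?_
    obtain ⟨N, hN⟩ := exists_nat_gt (1 / r)
    refine (eventually_ge_atTop N).mono fun n hn => ?_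
    have h1 : 1 ≤ ((n : ℝ) + 1) * r := by
      have hN' : 1 / r < (n : ℝ) + 1 := hN.trans_le (by exact_mod_cast Nat.le_succ_of_le hn)
      rw [div_lt_iff₀ hr] at hN'
      linarith
    exact (Real.smoothTransition.one_of_one_le h1).symm
  · rw [if_neg hr]
    refine tendsto_const_nhds.congr' (Eventually.of_forall fun n => ?_)
    exact (Real.smoothTransition.zero_of_nonpos
      (mul_nonpos_of_nonneg_of_nonpos (by positivity) (not_lt.1 hr))).symm

omit [DecidableEq d] in
/-- **Dominated convergence against the approximate indicators**: for smooth `θ` and continuous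
`G` on `T^d`, `∫ gₙ(θ) G → ∫_{x : θ(x) > 0} G` (`gₙ(θ) → 1_{θ > 0}` pointwise, `|gₙ| ≤ 1`). The
level-set bookkeeping step of the Kružkov / DiPerna–Lions renormalisation arguments of this file,
isolated. [cite: DiPernaLions1989Invent, §II.3] -/
theorem tendsto_integral_approxIndicator_mul {θ G : UnitAddTorus d → ℝ}
    (hθ : FunctionSpaces.Torus.IsSmooth θ) (hG : Continuous G) :
    Tendsto (fun n : ℕ => ∫ x, Real.smoothTransition (((n : ℝ) + 1) * θ x) * G x) atTop
      (𝓝 (∫ x in {x | 0 < θ x}, G x)) := by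
  have hθc := hθ.continuous
  have hSm : MeasurableSet {x | 0 < θ x} := measurableSet_lt measurable_const hθc.measurable
  rw [← integral_indicator hSm]
  show Tendsto (fun n : ℕ => ∫ x, Real.smoothTransition (((n : ℝ) + 1) * θ x) * G x) atTop
    (𝓝 (∫ x, {x | 0 < θ x}.indicator G x))
  refine tendsto_integral_of_dominated_convergence (fun x => ‖G x‖) (fun n => ?_)
    hG.integrable_unitAddTorus.norm (fun n => ae_of_all _ fun x => ?_) (ae_of_all _ fun x => ?_)
  · exact (((contDiff_approxIndicator n).continuous.comp hθc).mul hG).aestronglyMeasurable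
  · rw [norm_mul, Real.norm_eq_abs, abs_of_nonneg (approxIndicator_mem_Icc n _).1]
    exact mul_le_of_le_one_left (norm_nonneg _) (approxIndicator_mem_Icc n _).2
  · have h := (tendsto_approxIndicator (θ x)).mul_const (G x)
    by_cases hw : 0 < θ x
    · rw [indicator_of_mem (show x ∈ {x | 0 < θ x} from hw)]
      simpa [if_pos hw] using h
    · rw [indicator_of_notMem (show x ∉ {x | 0 < θ x} from hw)]
      simpa [if_neg hw] using h

/-- **Integration by parts against a function of a scalar field** (coordinates): for smooth `θ`,
smooth scalar fields `Fₖ` and smooth `g : ℝ → ℝ` on `T^d`,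
`∫ g'(θ) ∑ₖ ∂ₖθ Fₖ = −∫ g(θ) ∑ₖ ∂ₖFₖ` — `g'(θ)∂ₖθ = ∂ₖ(g ∘ θ)` and `∫ ∂ₖ((g ∘ θ) Fₖ) = 0` on the
torus (Evans, App. C.2, Thm. 2, no boundary; tree `Torus.integral_partialDeriv_eq_zero_holds`).
[cite: Evans2010, App. C.2 Thm. 2] -/
theorem integral_deriv_comp_mul_sum_partialDeriv_mul_eq {θ : UnitAddTorus d → ℝ}
    {F : d → UnitAddTorus d → ℝ} (hθ : FunctionSpaces.Torus.IsSmooth θ)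
    (hF : ∀ k, FunctionSpaces.Torus.IsSmooth (F k)) {g : ℝ → ℝ} (hg : ContDiff ℝ ∞ g) :
    ∫ x, deriv g (θ x) * ∑ k, FunctionSpaces.Torus.partialDeriv k θ x * F k x =
      -∫ x, g (θ x) * ∑ k, FunctionSpaces.Torus.partialDeriv k (F k) x := by
  have hθ1 : FunctionSpaces.Torus.IsContDiff 1 θ := hθ.isContDiff (by simp)
  have hgθ : FunctionSpaces.Torus.IsSmooth (g ∘ θ) := hθ.comp_left hg
  have hgθ1 : FunctionSpaces.Torus.IsContDiff 1 (g ∘ θ) := hgθ.isContDiff (by simp)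
  have hF1 : ∀ k, FunctionSpaces.Torus.IsContDiff 1 (F k) := fun k => (hF k).isContDiff (by simp)
  have hg1 : ContDiff ℝ 1 g := hg.of_le (by simp)
  -- smoothness of the products that occur
  have hsA : ∀ k, FunctionSpaces.Torus.IsSmooth
      (fun x => FunctionSpaces.Torus.partialDeriv k (g ∘ θ) x * F k x) :=
    fun k => ContDiff.mul (hgθ.partialDeriv k) (hF k)
  have hsB : ∀ k, FunctionSpaces.Torus.IsSmooth
      (fun x => (g ∘ θ) x * FunctionSpaces.Torus.partialDeriv k (F k) x) :=
    fun k => ContDiff.mul hgθ ((hF k).partialDeriv k)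
  have hsP : ∀ k, FunctionSpaces.Torus.IsSmooth (fun x => (g ∘ θ) x * F k x) :=
    fun k => ContDiff.mul hgθ (hF k)
  -- pointwise: `g'(θ) ∑ₖ ∂ₖθ Fₖ = ∑ₖ ∂ₖ(g ∘ θ) Fₖ`
  have e1 : ∀ x, deriv g (θ x) * ∑ k, FunctionSpaces.Torus.partialDeriv k θ x * F k x =
      ∑ k, FunctionSpaces.Torus.partialDeriv k (g ∘ θ) x * F k x := fun x => by
    rw [Finset.mul_sum]
    refine Finset.sum_congr rfl fun k _ => ?_
    rw [partialDeriv_comp_left hg1 hθ1 k x]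
    ring
  -- per coordinate: `∫ ∂ₖ(g ∘ θ) Fₖ = −∫ (g ∘ θ) ∂ₖFₖ`
  have e2 : ∀ k, ∫ x, FunctionSpaces.Torus.partialDeriv k (g ∘ θ) x * F k x =
      -∫ x, g (θ x) * FunctionSpaces.Torus.partialDeriv k (F k) x := by
    intro k
    have h0 := FunctionSpaces.Torus.integral_partialDeriv_eq_zero_holds (hsP k) k
    have epd : ∀ x, FunctionSpaces.Torus.partialDeriv k (fun y => (g ∘ θ) y * F k y) x =
        (g ∘ θ) x * FunctionSpaces.Torus.partialDeriv k (F k) x +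
          FunctionSpaces.Torus.partialDeriv k (g ∘ θ) x * F k x :=
      fun x => FunctionSpaces.Torus.partialDeriv_mul hgθ1 (hF1 k) k x
    simp_rw [epd] at h0
    rw [integral_add (hsB k).integrable (hsA k).integrable] at h0
    have e : ∫ x, (g ∘ θ) x * FunctionSpaces.Torus.partialDeriv k (F k) x =
        ∫ x, g (θ x) * FunctionSpaces.Torus.partialDeriv k (F k) x := rfl
    linarith
  calc ∫ x, deriv g (θ x) * ∑ k, FunctionSpaces.Torus.partialDeriv k θ x * F k x
      = ∫ x, ∑ k, FunctionSpaces.Torus.partialDeriv k (g ∘ θ) x * F k x :=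
        integral_congr_ae (Eventually.of_forall e1)
    _ = ∑ k, ∫ x, FunctionSpaces.Torus.partialDeriv k (g ∘ θ) x * F k x :=
        integral_finsetSum _ fun k _ => (hsA k).integrable
    _ = ∑ k, -∫ x, g (θ x) * FunctionSpaces.Torus.partialDeriv k (F k) x :=
        Finset.sum_congr rfl fun k _ => e2 k
    _ = -∫ x, g (θ x) * ∑ k, FunctionSpaces.Torus.partialDeriv k (F k) x := by
        have iB : ∀ k, Integrable (fun x => g (θ x) * FunctionSpaces.Torus.partialDeriv k (F k) x)
            (volume : Measure (UnitAddTorus d)) := fun k => (hsB k).integrable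
        rw [Finset.sum_neg_distrib, ← integral_finsetSum _ fun k _ => iB k]
        congr 1
        exact integral_congr_ae (Eventually.of_forall fun x => (Finset.mul_sum _ _ _).symm)

/-- **Smeared Gauss–Green on a super-level set.** For smooth `θ` and smooth scalar fields `Fₖ` on
`T^d`, with the approximate indicators `gₙ(r) = smoothTransition((n+1) r)` (`gₙ' ≥ 0` supported
in the band `0 ≤ r ≤ 1/(n+1)`, `∫ gₙ' = 1`):
`∫ gₙ'(θ) ∑ₖ ∂ₖθ Fₖ → −∫_{x : θ(x) > 0} ∑ₖ ∂ₖFₖ` as `n → ∞` — the integral of the divergence of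
`F` over the super-level set `{θ > 0}` is (minus) the limit of the fluxes of `F` against `∇θ`
through the thin nodal bands `{0 < θ < 1/(n+1)}`. When `0` is a regular value of `θ` this is the
Gauss–Green formula `∫_U div F dx = ∫_{∂U} F·ν dS` for `U = {θ > 0}`, outward normal
`ν = −∇θ/|∇θ|` (Evans, App. C.2, Thm. 1); the smeared form holds with no regularity of the
level set. [cite: Evans2010, App. C.2 Thm. 1] -/
theorem tendsto_integral_thinBand_flux {θ : UnitAddTorus d → ℝ} {F : d → UnitAddTorus d → ℝ}
    (hθ : FunctionSpaces.Torus.IsSmooth θ) (hF : ∀ k, FunctionSpaces.Torus.IsSmooth (F k)) :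
    Tendsto (fun n : ℕ => ∫ x, deriv (fun r => Real.smoothTransition (((n : ℝ) + 1) * r)) (θ x) *
        ∑ k, FunctionSpaces.Torus.partialDeriv k θ x * F k x) atTop
      (𝓝 (-(∫ x in {x | 0 < θ x}, ∑ k, FunctionSpaces.Torus.partialDeriv k (F k) x))) := by
  have hG : Continuous fun x => ∑ k, FunctionSpaces.Torus.partialDeriv k (F k) x :=
    continuous_finsetSum _ fun k _ => ((hF k).partialDeriv k).continuous
  have h := (tendsto_integral_approxIndicator_mul hθ hG).neg
  refine h.congr fun n => ?_
  exact (integral_deriv_comp_mul_sum_partialDeriv_mul_eq hθ hF (contDiff_approxIndicator n)).symm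

end SuperlevelFlux

end Torus

end Literature.Analysis.FluidPDE
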